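import Summits.ResolutionOfSingularities.ResolutionOfSingularities.Theses.JacobianBudget
import Summits.ResolutionOfSingularities.ResolutionOfSingularities.Theorems.WildConesClassicalRegimesDefs
import HarnessLib

/-!
# Route `JacobianBudget`, crux `IsolatedJacobianDrop` (stmt-ResolutionOfSingularities-18946) — the
# line's vocabulary NAMED, the stub statements of line `euler-noether`, and the crux re-pointed

The crux `Theses.JacobianBudget.IsolatedJacobianDrop` shares its fourteen `let`-bound definitions
(`clean bl ord dv tr step run ser pd jac Isol MultP mu` and `Δ`) VERBATIM with the sibling routes
`FrobeniusClosing` / `WildCones`; the first thirteen are the landed Theorems-side calculus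
`Theorems/WildConesClassicalRegimesDefs.lean` (namespace `…Theorems.WildCones`, explicit arguments
`p n κ`), which this file re-uses rather than copying a fourth time (so the landed kits `MuDropCurve.*`,
`MuDropSurface.surfaceDict`, `NarrowRunsDie.stub_dict`, `FrobeniusClosing.chartMap` apply on the nose).
This file adds what line `euler-noether` (`Cruxes/IsolatedJacobianDrop/Lines/euler_noether.lean`, lead's
reshape v1, 2026-08-17) cuts the crux into:

* the decrement `Δ p n` (verbatim the crux's `let Δ`) and `Δ_one : Δ p 1 = p`;
* the exceptional-divisor vocabulary `form` (homogeneous forms of the cleaned state), `excIdeal`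
  (`(∂₁F, …, ∂ₙF, G)`), `ExcFinite` (its projective zero set is finite, chart by chart), `pt` / `NF`
  (points of `E(κ)` presented as (chart, translation), normal form), `toFun` / `ofFun` / `locT`
  (controlled transforms at an exceptional point, through the calculus' `tr ∘ dv ∘ bl`);
* the one-step form `SingleStepDrop` of the crux and the bridge `isolatedJacobianDrop_of_singleStepDrop`
  (definitional: the crux's `let`s ARE these definitions);
* the seven stub statements `SingleStepN1`, `BaseChange`, `NoExcess`, `EulerTransform`,
  `PolarAdditivity`, `MixedNoether`, `ExceptionalBudget` (target of `stub_budgetOfEngines`) as named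
  propositions, and their by-stub-name aliases `Sig.stub_<name>` (the skeleton audit admits a
  hypothesis of the composition only under the stub's name).

They live under `Theorems/` so that the stub files `Theorems/JacobianBudgetIsolatedJacobianDrop….lean`
and the final assembly can import them — the same arrangement as `Theorems/WildConesClassicalRegimesDefs.lean`
and `Theorems/FrobeniusClosingDefs.lean`. No theorem with content is proved here: definitions, one
arithmetic identity and one definitional bridge. Nothing here is a published result; the Props are
route-posited sub-statements of the line (informal sources: Fulton, *Intersection Theory*, Ex. 7.1.11,
12.4.8; Casas-Alvero, *Singular Points of Plane Curves*, Thm 3.3.1; Teissier, Astérisque 7–8 (1973) §II).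
-/

-- single-problem summit: the doubled namespace component `ResolutionOfSingularities` is forced
set_option linter.dupNamespace false

noncomputable section

open scoped BigOperators Classical

open Summit.ResolutionOfSingularities.ResolutionOfSingularities.Theses.JacobianBudget (IsolatedJacobianDrop)
open Summit.ResolutionOfSingularities.ResolutionOfSingularities.Theorems.WildCones
  (clean bl ord dv tr step run ser pd jac Isol MultP mu)

namespace Summit.ResolutionOfSingularities.ResolutionOfSingularities.Theorems.JacobianBudget

/-! ## New vocabulary of the line -/

section Vocabulary
variable {n : ℕ} {κ : Type} [Field κ]

/-- the universal decrement `Δ_n(p) = ((p-1)^n (p+1) - (-1)^n)/p` (`Δ₁ = p`, `Δ₂ = p² - p - 1`,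
`Δ₃(3) = 11`, `Δ₄(3) = 21`, `Δ₃(5) = 77`), verbatim the crux's `let Δ`. [folklore] -/
def Δ (p n : ℕ) : ℕ := ((p - 1) ^ n * (p + 1) + 1 - 2 * ((n + 1) % 2)) / p

/-- coefficient function of a power series. [folklore] -/
def toFun (f : MvPowerSeries (Fin n) κ) : (Fin n → ℕ) → κ :=
  fun A => f (Finsupp.equivFunOnFinite.symm A)

/-- power series of a coefficient function. [folklore] -/
def ofFun (c : (Fin n → ℕ) → κ) : MvPowerSeries (Fin n) κ :=
  show MvPowerSeries (Fin n) κ from fun A : Fin n →₀ ℕ => c ⇑A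

/-- the degree-`d` homogeneous form of the cleaned state, as a polynomial in the `n` coordinates
(`form p p c = F`, the tangent form; `form p (p+1) c = G`). [folklore] -/
def form (p d : ℕ) (c : (Fin n → ℕ) → κ) : MvPolynomial (Fin n) κ :=
  ∑ A ∈ Finset.Nat.antidiagonalTuple n d,
    MvPolynomial.monomial (Finsupp.equivFunOnFinite.symm A) (clean p n κ c A)

/-- the EXCEPTIONAL CRITICAL IDEAL `(∂₁F, …, ∂ₙF, G)`: its projective zero set in `E ≅ ℙⁿ⁻¹` is the zero
locus on the exceptional divisor of `d a'`. [folklore] -/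
def excIdeal (p : ℕ) (c : (Fin n → ℕ) → κ) : Ideal (MvPolynomial (Fin n) κ) :=
  Ideal.span (insert (form p (p + 1) c) (Set.range fun i => MvPolynomial.pderiv i (form p p c)))

/-- NO-EXCESS predicate: the projective zero set of `excIdeal` is finite — chart by chart, every
dehomogenisation `x_j = 1` is a finite-dimensional algebra. [folklore] -/
def ExcFinite (p : ℕ) (c : (Fin n → ℕ) → κ) : Prop :=
  ∀ j : Fin n, Module.Finite κ
    (MvPolynomial (Fin n) κ ⧸ (excIdeal p c ⊔ Ideal.span {MvPolynomial.X j - 1}))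

/-- homogeneous coordinates of the exceptional point presented as (chart `q.1`, translation `q.2`):
`[τ₁ : … : 1 (slot q.1) : … : τₙ]`. [folklore] -/
def pt (q : Fin n × (Fin n → κ)) : Fin n → κ := Function.update q.2 q.1 1

/-- NORMAL FORM of an exceptional point: its chart is the LAST nonzero homogeneous coordinate, so the
translation vanishes at and after the chart index (unique presentation of each point of `E(κ)`). [folklore] -/
def NF (q : Fin n × (Fin n → κ)) : Prop := ∀ i, q.1 ≤ i → q.2 i = 0

/-- the `k`-controlled transform `u^{-k} f̃` of a power series `f` of order `≥ k` at the exceptional point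
`q`, as a power series in the chart coordinates centred at `q` (Taylor expansion = `tr`, exact). [folklore] -/
def locT (q : Fin n × (Fin n → κ)) (k : ℕ) (f : MvPowerSeries (Fin n) κ) : MvPowerSeries (Fin n) κ :=
  ofFun (tr n κ q.1 q.2 k (dv n κ q.1 k (bl n κ q.1 (toFun f))))

end Vocabulary

/-! ## The one-step form of the crux and the definitional bridge -/

/-- ONE-STEP DROP over the named calculus (equivalent to the crux: every `(c, i, τ)` is a run of
length one, and `run (m+1) = step (i m) (t m) (run m)` definitionally). Internal node, NOT a stub. [folklore] -/
def SingleStepDrop : Prop :=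
  ∀ p : ℕ, p.Prime → ∀ n : ℕ, 0 < n → ∀ (κ : Type) [Field κ] [CharP κ p] [PerfectField κ]
    (c : (Fin n → ℕ) → κ) (i : Fin n) (τ : Fin n → κ),
    Isol p n κ c → MultP p n κ c → Isol p n κ (step p n κ i τ c) → MultP p n κ (step p n κ i τ c) →
      mu p n κ (step p n κ i τ c) + Δ p n ≤ mu p n κ c

/-! ## The stub STATEMENTS as named propositions -/

/-- **S7 · the curve case `n = 1` (base of the induction; provable now).** For `n = 1`, `bl` and `tr`
are the identity, a cleaned series `Σ c_k u^k` (`p ∤ k`) of order `d ≥ p` (so `d ≥ p + 1`) has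
`μ = d - 1`, the step divides by `u^p` and re-cleans nothing, so `μ' = d - p - 1`: the drop is EXACTLY
`p = Δ_1(p)` (the sibling's `WildCones.stub_muDropCurve` computes both colengths; the tree's
`Negative/TightN1.lean` is the instance `u⁵ ↦ u³`, `p = 2`). [folklore] -/
def SingleStepN1 : Prop :=
  ∀ p : ℕ, p.Prime → ∀ (κ : Type) [Field κ] [CharP κ p] [PerfectField κ]
    (c : (Fin 1 → ℕ) → κ) (i : Fin 1) (τ : Fin 1 → κ),
    Isol p 1 κ c → MultP p 1 κ c → Isol p 1 κ (step p 1 κ i τ c) → MultP p 1 κ (step p 1 κ i τ c) →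
      mu p 1 κ (step p 1 κ i τ c) + p ≤ mu p 1 κ c

/-- **S1 · base change.** `Isol`, `MultP`, `mu` are invariant under extension of the ground field and
`step` commutes with it (`clean`, `bl`, `dv`, `tr` are coefficientwise; an ideal of `κ[[u]]` of finite
colength contains `𝔪^N`, truncate and tensor). [folklore] -/
def BaseChange : Prop :=
  ∀ (p n : ℕ) (κ L : Type) [Field κ] [Field L] [Algebra κ L]
    (c : (Fin n → ℕ) → κ) (i : Fin n) (τ : Fin n → κ),
    (Isol p n κ c ↔ Isol p n L (fun A => algebraMap κ L (c A))) ∧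
    (MultP p n κ c ↔ MultP p n L (fun A => algebraMap κ L (c A))) ∧
    mu p n κ c = mu p n L (fun A => algebraMap κ L (c A)) ∧
    (fun A => algebraMap κ L (step p n κ i τ c A)) =
      step p n L i (fun j => algebraMap κ L (τ j)) (fun A => algebraMap κ L (c A))

/-- **S2 · no excess (projective geometry of the tangent form + Krull at the cone vertex).** Over an
algebraically closed field of characteristic `p`: if `c` is isolated of multiplicity `p` and its
successor at the exceptional point `(i, τ)` is again isolated of multiplicity `p`, then the exceptional
critical scheme `V(∂₁F, …, ∂ₙF, G) ⊂ ℙⁿ⁻¹` of `c` is finite. [folklore] -/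
def NoExcess : Prop :=
  ∀ p : ℕ, p.Prime → ∀ n : ℕ, 0 < n → ∀ (L : Type) [Field L] [CharP L p] [IsAlgClosed L]
    (c : (Fin n → ℕ) → L) (i : Fin n) (τ : Fin n → L),
    Isol p n L c → MultP p n L c → Isol p n L (step p n L i τ c) → MultP p n L (step p n L i τ c) →
      ExcFinite p c

/-- **The EXCEPTIONAL BUDGET (conservation law, inequality form).** Over an algebraically closed field of
characteristic `p`: if `c` is isolated of multiplicity `p` with finite exceptional critical scheme, then
for every finite set `S` of pairwise distinct exceptional points (any chart/translation presentation)
`Σ_{Q ∈ S} μ(step_Q c) + Δ_n(p) ≤ μ(c)`. The expected truth is the EQUALITY over all `Q ∈ E`.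
Target of `stub_budgetOfEngines`. [folklore] -/
def ExceptionalBudget : Prop :=
  ∀ p : ℕ, p.Prime → ∀ n : ℕ, 0 < n → ∀ (L : Type) [Field L] [CharP L p] [IsAlgClosed L]
    (c : (Fin n → ℕ) → L), Isol p n L c → MultP p n L c → ExcFinite p c →
    ∀ S : Finset (Fin n × (Fin n → L)),
      (S : Set (Fin n × (Fin n → L))).Pairwise (fun q q' => ∀ l : L, pt q' ≠ l • pt q) →
      (∑ q ∈ S, mu p n L (step p n L q.1 q.2 c)) + Δ p n ≤ mu p n L c

/-- **S3 · the Euler transform identity (FIRST LEMMA; provable now).** In characteristic `p`, for a state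
of multiplicity `p` and the AXIS successor of chart `i` (`τ = 0`): for `j ≠ i` the `j`-th partial of the
successor is the `(p-1)`-controlled transform of `∂_j a`, and the `i`-th partial is the
`(p+1)`-controlled transform of the Euler derivative `θa = Σ_j u_j ∂_j a`. Coefficientwise both sides are
`(B_j+1)·[Σ_{k≠i}B_k ≤ B_i+p-1]·clean c (A)`, resp. `(B_i+1) ≡ |A| (mod p)` with `|A| = B_i+p+1`. [folklore] -/
def EulerTransform : Prop :=
  ∀ p : ℕ, p.Prime → ∀ n : ℕ, 0 < n → ∀ (L : Type) [Field L] [CharP L p]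
    (c : (Fin n → ℕ) → L) (i : Fin n), MultP p n L c →
    (∀ j, j ≠ i →
      pd n L j (ser p n L (step p n L i 0 c)) =
        show MvPowerSeries (Fin n) L from fun A : Fin n →₀ ℕ =>
          dv n L i (p - 1) (bl n L i (fun B => pd n L j (ser p n L c) (Finsupp.equivFunOnFinite.symm B))) ⇑A) ∧
    pd n L i (ser p n L (step p n L i 0 c)) =
      show MvPowerSeries (Fin n) L from fun A : Fin n →₀ ℕ =>
        dv n L i (p + 1) (bl n L i (fun B => (∑ j, MvPowerSeries.X j * pd n L j (ser p n L c) : MvPowerSeries (Fin n) L)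
          (Finsupp.equivFunOnFinite.symm B))) ⇑A

/-- **S4 · polar additivity (Lê–Teissier shape; commutative algebra of complete intersections).** In
`R = L[[u₁, …, uₙ]]`, for `k < n` series `g₁, …, g_k` and `x, y` with `R ⧸ (g, x)` and `R ⧸ (g, y)`
finite over `L`: `dim_L R ⧸ (g, x·y) = dim_L R ⧸ (g, x) + dim_L R ⧸ (g, y)` (vacuous unless
`k = n - 1` by Krull — tree: `SopRegular.ringKrullDim_le_length_of_maximalIdeal_pow_le`; then `(g, x)`
is a system of parameters of the regular local ring `R`, hence a regular sequence —
tree: `SopRegular.isRegular_of_maximalIdeal_pow_le_ofList` — and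
`0 → R⧸(g,y) →·x R⧸(g,xy) → R⧸(g,x) → 0` is exact; tree: `ColengthFinrank.finrank_quotient_eq_colon_add`). [folklore] -/
def PolarAdditivity : Prop :=
  ∀ (n k : ℕ), k < n → ∀ (L : Type) [Field L]
    (g : Fin k → MvPowerSeries (Fin n) L) (x y : MvPowerSeries (Fin n) L),
    Module.Finite L (MvPowerSeries (Fin n) L ⧸ (Ideal.span (Set.range g) ⊔ Ideal.span {x})) →
    Module.Finite L (MvPowerSeries (Fin n) L ⧸ (Ideal.span (Set.range g) ⊔ Ideal.span {y})) →
    Module.finrank L (MvPowerSeries (Fin n) L ⧸ (Ideal.span (Set.range g) ⊔ Ideal.span {x * y})) =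
      Module.finrank L (MvPowerSeries (Fin n) L ⧸ (Ideal.span (Set.range g) ⊔ Ideal.span {x})) +
      Module.finrank L (MvPowerSeries (Fin n) L ⧸ (Ideal.span (Set.range g) ⊔ Ideal.span {y}))

/-- **S5 · MAX NOETHER IN DIMENSION `n` FOR MIXED TRANSFORMS (the intersection-theoretic heart).** Over an
algebraically closed field `L`, in `R = L[[u₁, …, uₙ]]`: let `f₁, …, fₙ` generate an ideal of finite
colength, `k_i ≤ ord f_i`, and suppose the `k`-controlled transforms `u^{-k_i} f̃_i` on the blow-up of
the closed point have only finitely many common zeros on `E ≅ ℙⁿ⁻¹` — listed without repetition, in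
normal form, by `S` (every normal-form point outside `S` is a non-zero of some transform). Then
`dim_L R ⧸ (f) = k₁⋯kₙ + Σ_{Q ∈ S} dim_L L[[v]] ⧸ (transforms at Q)` (Fulton, Intersection Theory,
Ex. 12.4.8 (a); `n = 2` is Noether's formula plus additivity). [folklore] -/
def MixedNoether : Prop :=
  ∀ n : ℕ, 0 < n → ∀ (L : Type) [Field L] [IsAlgClosed L]
    (f : Fin n → MvPowerSeries (Fin n) L) (k : Fin n → ℕ),
    Module.Finite L (MvPowerSeries (Fin n) L ⧸ Ideal.span (Set.range f)) →
    (∀ i (A : Fin n →₀ ℕ), f i A ≠ 0 → k i ≤ A.sum (fun _ e => e)) →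
    ∀ S : Finset (Fin n × (Fin n → L)),
      (∀ q ∈ S, NF q) →
      (∀ q, NF q → q ∉ S → Ideal.span (Set.range fun i => locT q (k i) (f i)) = ⊤) →
      Module.finrank L (MvPowerSeries (Fin n) L ⧸ Ideal.span (Set.range f)) =
        (∏ i, k i) +
          ∑ q ∈ S, Module.finrank L
            (MvPowerSeries (Fin n) L ⧸ Ideal.span (Set.range fun i => locT q (k i) (f i)))

/-! ## The stub statements BY STUB NAME (`Sig.stub_<name>`; the skeleton audit admits a hypothesis of
the composition only when its head constant carries the stub's name) -/

/-- statement of `stub_singleStepN1`. [folklore] -/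
abbrev Sig.stub_singleStepN1 : Prop := SingleStepN1
/-- statement of `stub_baseChange`. [folklore] -/
abbrev Sig.stub_baseChange : Prop := BaseChange
/-- statement of `stub_noExcess`. [folklore] -/
abbrev Sig.stub_noExcess : Prop := NoExcess
/-- statement of `stub_eulerTransform`. [folklore] -/
abbrev Sig.stub_eulerTransform : Prop := EulerTransform
/-- statement of `stub_polarAdditivity`. [folklore] -/
abbrev Sig.stub_polarAdditivity : Prop := PolarAdditivity
/-- statement of `stub_mixedNoether`. [folklore] -/
abbrev Sig.stub_mixedNoether : Prop := MixedNoether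
/-- statement of `stub_budgetOfEngines`: the exceptional budget from the three engines. [folklore] -/
abbrev Sig.stub_budgetOfEngines : Prop := EulerTransform → PolarAdditivity → MixedNoether → ExceptionalBudget

/-! ## `Δ₁ = p` and the definitional bridge to the crux -/

/-- `Δ_1(p) = p`. [folklore] -/
theorem Δ_one (p : ℕ) (hp : p.Prime) : Δ p 1 = p := by
  unfold Δ
  have h2 : 2 ≤ p := hp.two_le
  have h : (p - 1) ^ 1 * (p + 1) + 1 - 2 * ((1 + 1) % 2) = p * p := by
    rw [pow_one]
    obtain ⟨q, rfl⟩ : ∃ q, p = q + 1 := ⟨p - 1, by omega⟩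
    simp
    ring
  rw [h, Nat.mul_div_cancel _ hp.pos]

/-- **The one-step form implies the crux BY NAME** — definitional: the crux's fourteen `let`s are the
`WildCones` definitions and `Δ` verbatim, so after `intro` the identification with `SingleStepDrop`
at `(run m, i m, t m)` is by `exact`. [folklore] -/
theorem isolatedJacobianDrop_of_singleStepDrop (h : SingleStepDrop) : IsolatedJacobianDrop := by
  intro p hp n hn κ _ _ _ c₀ i t clean' bl' ord' dv' tr' step' run' ser' pd' jac' Isol' MultP' mu' Δ' m
    k1 k2 k3 k4
  exact h p hp n hn κ (run p n κ c₀ i t m) (i m) (t m) k1 k2 k3 k4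

end Summit.ResolutionOfSingularities.ResolutionOfSingularities.Theorems.JacobianBudget

end
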